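import Summits.QuantumFields.YangMills.Theorems.LuscherReductionTwistedTraceScalingBOCentralModel
import HarnessLib

/-!
# (C1d-β) THE CHART CORE OF `SU(2)^E` FOR THE CENTRAL GAUSSIAN: the core set `gnCore`, the far kernel bound, the chart representation of the core part, and the pointwise sandwich
# (lane A of S-BASE, crux `TwistedTraceScaling` stmt-QuantumFields-20203, C4-CORE, the (OD) pen, brick (C1d) of `pub/ym-fleet/ym-luscher-20007-p1/COARSE-DESIGN.md` §27.8–§27.9)

The `SU(2)^E` plumbing of the central Gaussian evaluation `∫_V K_β(P(w'), V)·G(V) dμ(V)` (`…BOCentralGaussian`), around a centre `P(w')` on the vacuum pattern of the lattice gnomonic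
chart (`…LatticeGnChart.latPatternChart L (fun _ ↦ false)`) with `Σ_a w'_e a² ≤ ρ'²`, `4ρ' ≤ ρ ≤ 1/2`:
* §1 `gnCore L ρ` — the chart core as a measurable subset of `SU(2)^E` (`scalarPart > 0` and `|vecPart|² ≤ ρ²·scalarPart²` on every link); `P(w) ∈ gnCore ρ ↔ ∀e, Σ_a w_e a² ≤ ρ²`;
* §2 ★ `transferKernel_far_le` — off the core the kernel is flat-small: `K_β(P(w'), V) ≤ e^{2β|E|}·e^{−βρ²/4}` for `V ∉ gnCore ρ` (one link is at quaternion distance² `≥ ρ²/4` from the centre,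
  `quatDist_sq_ge_of_exit`; `…ElectricSplit.latE_eq_exp_frobSq`, `…TangentChart.frobNorm_sub_sq_eq`, `transferKernel_le_latE`);
* §3 `integral_indicator_gnCore_eq_chart` — the core part of `∫ F dμ` is a Lebesgue integral over the chart ball against `∏_e w(w_e)` (`…VacuumPattern.integral_configMeasure_eq_vacuumChart`);
  `core_part_eq_chart` (the instance `F = K_β(P w', ·)·G`), `integrable_transferKernel_mul`, `measurable_chart_integrand`, `integrable_gauss_shift_chart`;
* §4 ★ `chart_integrand_lower` / ★ `chart_integrand_upper` — pointwise sandwich of `(∏ w(w_e))·K·G` on the ball against the flat model integrand of `…BOCentralModel`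
  (`…KernelChartSandwich.transferKernel_chart_sandwich`, `…ChartTransport` density bounds; the upper kinetic Gaussian `e^{−β(1+ρ²)⁻²‖d‖²}` is `≤ e^{8|E|βρ⁴}·e^{−β‖d‖²}` on the ball,
  `exp_kinetic_upper_le`).
HONEST FRAMING: Laplace plumbing for a stub of a child of the CONDITIONAL route R2b1; (C1c), (C4), (C5), (B-ST) OPEN; C4-CORE OPEN; not infinite volume, not a gap, not Clay.
-/

set_option autoImplicit false

noncomputable section

open MeasureTheory Filter Topology Real
open scoped BigOperators RealInnerProductSpace
open Literature.MathematicalPhysics.QuantumFieldTheory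
open Literature.MathematicalPhysics.QuantumLattice
open Literature.MathematicalPhysics.QuantumFieldTheory.Balaban1983to89.T4CubeChartGnomonic (gnoPoint)

namespace Summit.QuantumFields.YangMills.Theorems.FemtoTransferGap.TwoLattice.ConstTube

open Summit.QuantumFields.YangMills.Theorems.FemtoTransferGap
open Summit.QuantumFields.YangMills.Theorems.FemtoTransferGap.TwoLattice
open Summit.QuantumFields.YangMills.Theorems.FemtoTransferGap.TwoLattice.Stiff
open Summit.QuantumFields.YangMills.Theorems.FemtoTransferGap.TwoLattice.GnChart
open Summit.QuantumFields.YangMills.Theorems.FemtoTransferGap.TwoLattice.Chart (frobNorm_sub_sq_eq)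
open Summit.QuantumFields.YangMills.Theorems.FemtoTransferGap.TwoLattice.Electric (latE_eq_exp_frobSq)

variable (L : ℕ) [NeZero L]

/-! ## §1 The chart core as a subset of `SU(2)^E` -/

/-- **The chart core of radius `ρ`**: every link in the open upper hemisphere with gnomonic coordinate of length `≤ ρ` (`|vecPart|² ≤ ρ²·scalarPart²`). [folklore] -/
def gnCore (ρ : ℝ) : Set (GaugeConfig 3 L SU2) := {V | ∀ e : Edge 3 L, 0 < scalarPart (V e) ∧ ∑ a, vecPart (V e) a ^ 2 ≤ ρ ^ 2 * scalarPart (V e) ^ 2}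

variable {L}

/-- The chart core is measurable. [folklore] -/
theorem measurableSet_gnCore (ρ : ℝ) : MeasurableSet (gnCore L ρ) := by
  haveI : SecondCountableTopology SU2 := secondCountableTopology_su2
  have hs : ∀ e : Edge 3 L, Measurable fun V : GaugeConfig 3 L SU2 => scalarPart (V e) := fun e => continuous_scalarPart.measurable.comp (measurable_pi_apply e)
  have hv : ∀ (e : Edge 3 L) (a : Fin 3), Measurable fun V : GaugeConfig 3 L SU2 => vecPart (V e) a := fun e a =>
    (measurable_pi_apply a).comp (continuous_vecPart.measurable.comp (measurable_pi_apply e))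
  have h : gnCore L ρ = ⋂ e : Edge 3 L, ({V | 0 < scalarPart (V e)} ∩ {V | ∑ a, vecPart (V e) a ^ 2 ≤ ρ ^ 2 * scalarPart (V e) ^ 2}) := by
    ext V; simp [gnCore]
  rw [h]
  exact MeasurableSet.iInter fun e => (measurableSet_lt measurable_const (hs e)).inter
    (measurableSet_le (Finset.measurable_sum _ fun a _ => (hv e a).pow_const 2) (((hs e).pow_const 2).const_mul _))

omit [NeZero L] in
/-- A chart point lies in the core iff its coordinates lie in the ball: `P(w) ∈ gnCore ρ ↔ ∀ e, Σ_a w_e a² ≤ ρ²`. [folklore] -/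
theorem latPatternChart_mem_gnCore_iff (ρ : ℝ) (w : Edge 3 L → Fin 3 → ℝ) : latPatternChart L (fun _ => false) w ∈ gnCore L ρ ↔ ∀ e, ∑ a, w e a ^ 2 ≤ ρ ^ 2 := by
  simp only [gnCore, Set.mem_setOf_eq, latPatternChart_false]
  refine forall_congr' fun e => ?_
  obtain ⟨hs, _, hv⟩ := gnoPoint_chart (w e)
  have hsum : ∑ a, vecPart (gnoPoint (w e)) a ^ 2 = scalarPart (gnoPoint (w e)) ^ 2 * ∑ a, w e a ^ 2 := by
    rw [Finset.mul_sum]; exact Finset.sum_congr rfl fun a _ => by rw [hv a]; ring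
  rw [hsum]
  have hs2 : 0 < scalarPart (gnoPoint (w e)) ^ 2 := by positivity
  constructor
  · rintro ⟨_, h⟩; nlinarith
  · intro h; exact ⟨hs, by nlinarith⟩

omit [NeZero L] in
/-- A configuration with a link of non-positive scalar part is not in the core. [folklore] -/
theorem not_mem_gnCore_of_scalarPart_nonpos {ρ : ℝ} {V : GaugeConfig 3 L SU2} (h : ∃ e, scalarPart (V e) ≤ 0) : V ∉ gnCore L ρ := by
  obtain ⟨e, he⟩ := h
  intro hV; exact absurd (hV e).1 (not_lt.2 he)

/-! ## §2 Off the core the kernel is flat-small -/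

omit [NeZero L] in
/-- The quaternion distance from the centre link to a bad link: for `0 < ρ ≤ 1/2`, `0 ≤ ρ'`, `4ρ' ≤ ρ`, `Σ_a y_a² ≤ ρ'²` and a link `V` violating the core condition,
`ρ²/4 ≤ (s' − s)² + Σ_a (v'_a − v_a)²` (`(s',v') = P(1,y)`, `(s,v) = V`). [folklore] -/
theorem quatDist_sq_ge_of_exit {ρ ρ' : ℝ} (hρ : 0 < ρ) (hρ2 : ρ ≤ 1 / 2) (hρ'0 : 0 ≤ ρ') (hρ' : 4 * ρ' ≤ ρ) {y : Fin 3 → ℝ} (hy : ∑ a, y a ^ 2 ≤ ρ' ^ 2) {V : SU2}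
    (hV : ¬(0 < scalarPart V ∧ ∑ a, vecPart V a ^ 2 ≤ ρ ^ 2 * scalarPart V ^ 2)) :
    ρ ^ 2 / 4 ≤ (scalarPart (gnoPoint y) - scalarPart V) ^ 2 + ∑ a, (vecPart (gnoPoint y) a - vecPart V a) ^ 2 := by
  obtain ⟨hs', hs'eq, hv'⟩ := gnoPoint_chart y
  set s' := scalarPart (gnoPoint y) with hs'def
  set s := scalarPart V with hsdef
  have hy0 : 0 ≤ ∑ a, y a ^ 2 := Finset.sum_nonneg fun a _ => sq_nonneg _
  have hρ'1 : ρ' ^ 2 ≤ 1 := by nlinarith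
  have hsum0 : 0 ≤ ∑ a, (vecPart (gnoPoint y) a - vecPart V a) ^ 2 := Finset.sum_nonneg fun a _ => sq_nonneg _
  by_cases hsV : 0 < s
  · -- the bad link has `|v|² > ρ² s²`, hence `|v|² > ρ²/(1+ρ²) ≥ (4/5)ρ²`, while `|v'|² ≤ ρ'² ≤ ρ²/16`
    have hvV : ρ ^ 2 * s ^ 2 < ∑ a, vecPart V a ^ 2 := by
      by_contra h; exact hV ⟨hsV, not_lt.1 h⟩
    have hvV1 : ∑ a, vecPart V a ^ 2 = 1 - s ^ 2 := sum_vecPart_sq V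
    have hbig : 4 / 5 * ρ ^ 2 ≤ ∑ a, vecPart V a ^ 2 := by
      set X := ∑ a, vecPart V a ^ 2 with hX
      have hr0 : 0 < ρ ^ 2 := by positivity
      have hρsq : ρ ^ 2 ≤ 1 / 4 := by nlinarith
      have hs2 : s ^ 2 = 1 - X := by linarith
      have hX1 : ρ ^ 2 * (1 - X) < X := by rw [← hs2]; exact hvV
      by_contra hc
      have hc' : X < 4 / 5 * ρ ^ 2 := not_le.1 hc
      have h1 : ρ ^ 2 * X < ρ ^ 2 * (4 / 5 * ρ ^ 2) := mul_lt_mul_of_pos_left hc' hr0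
      have h2 : ρ ^ 2 * ρ ^ 2 ≤ ρ ^ 2 * (1 / 4) := mul_le_mul_of_nonneg_left hρsq hr0.le
      nlinarith
    have hsmall : ∑ a, vecPart (gnoPoint y) a ^ 2 ≤ ρ' ^ 2 := by
      have h1 : ∑ a, vecPart (gnoPoint y) a ^ 2 = s' ^ 2 * ∑ a, y a ^ 2 := by
        rw [Finset.mul_sum]; exact Finset.sum_congr rfl fun a _ => by rw [hv' a]; ring
      have hs'1 : s' ^ 2 ≤ 1 := by nlinarith
      rw [h1]; nlinarith
    set p : EuclideanSpace ℝ (Fin 3) := WithLp.toLp 2 (vecPart (gnoPoint y)) with hp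
    set p' : EuclideanSpace ℝ (Fin 3) := WithLp.toLp 2 (vecPart V) with hp'
    have hnp : ‖p‖ ^ 2 = ∑ a, vecPart (gnoPoint y) a ^ 2 := by rw [EuclideanSpace.norm_sq_eq]; simp [hp]
    have hnp' : ‖p'‖ ^ 2 = ∑ a, vecPart V a ^ 2 := by rw [EuclideanSpace.norm_sq_eq]; simp [hp']
    have hnd : ‖p - p'‖ ^ 2 = ∑ a, (vecPart (gnoPoint y) a - vecPart V a) ^ 2 := by rw [EuclideanSpace.norm_sq_eq]; simp [hp, hp']
    have hb : ‖p‖ ≤ ρ / 4 := by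
      have h1 : ‖p‖ ^ 2 ≤ (ρ / 4) ^ 2 := by rw [hnp]; nlinarith
      exact (pow_le_pow_iff_left₀ (norm_nonneg _) (by positivity) two_ne_zero).1 h1
    have ha : 3 * ρ / 4 < ‖p'‖ := by
      have h1 : (3 * ρ / 4) ^ 2 < ‖p'‖ ^ 2 := by rw [hnp']; nlinarith
      exact lt_of_pow_lt_pow_left₀ 2 (norm_nonneg _) h1
    have hd : ρ / 2 ≤ ‖p - p'‖ := by
      have h1 := norm_sub_norm_le p' p
      rw [norm_sub_rev] at h1
      linarith
    have hd2 : (ρ / 2) ^ 2 ≤ ‖p - p'‖ ^ 2 := pow_le_pow_left₀ (by positivity) hd 2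
    rw [← hnd]
    nlinarith [sq_nonneg (s' - s)]
  · -- the bad link has `s ≤ 0 < s'`, and `s'² ≥ 1/2`
    have hs0 : s ≤ 0 := not_lt.1 hsV
    have hs'2 : 1 / 2 ≤ s' ^ 2 := by nlinarith
    have h1 : s' ^ 2 ≤ (s' - s) ^ 2 := by nlinarith
    nlinarith

/-- ★ **Off the core the kernel is flat-small**: for `β ≥ 0`, `0 < ρ ≤ 1/2`, `0 ≤ ρ'`, `4ρ' ≤ ρ`, a centre `P(w')` with `Σ_a w'_e a² ≤ ρ'²` on every link and `V ∉ gnCore ρ`,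
`K_β(P(w'), V) ≤ e^{2β|E|}·e^{−βρ²/4}`. [folklore] -/
theorem transferKernel_far_le {β : ℝ} (hβ : 0 ≤ β) {ρ ρ' : ℝ} (hρ : 0 < ρ) (hρ2 : ρ ≤ 1 / 2) (hρ'0 : 0 ≤ ρ') (hρ' : 4 * ρ' ≤ ρ) {w' : Edge 3 L → Fin 3 → ℝ}
    (hw' : ∀ e, ∑ a, w' e a ^ 2 ≤ ρ' ^ 2) {V : GaugeConfig 3 L SU2} (hV : V ∉ gnCore L ρ) :
    transferKernel su2Rep β (latPatternChart L (fun _ => false) w') V ≤ Real.exp (2 * β) ^ Fintype.card (Edge 3 L) * Real.exp (-(β * ρ ^ 2 / 4)) := by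
  set U' := latPatternChart L (fun _ => false) w' with hU'
  -- a bad link
  have hbad : ∃ e, ¬(0 < scalarPart (V e) ∧ ∑ a, vecPart (V e) a ^ 2 ≤ ρ ^ 2 * scalarPart (V e) ^ 2) := by
    by_contra h
    push Not at h
    exact hV h
  obtain ⟨e₀, he₀⟩ := hbad
  have hdist : ρ ^ 2 / 2 ≤ frobNorm ((U' e₀ : Matrix (Fin 2) (Fin 2) ℂ) - (V e₀ : Matrix (Fin 2) (Fin 2) ℂ)) ^ 2 := by
    rw [frobNorm_sub_sq_eq, hU', latPatternChart_false]
    have h := quatDist_sq_ge_of_exit hρ hρ2 hρ'0 hρ' (hw' e₀) he₀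
    linarith
  have hsum : ρ ^ 2 / 2 ≤ ∑ e, frobNorm ((U' e : Matrix (Fin 2) (Fin 2) ℂ) - (V e : Matrix (Fin 2) (Fin 2) ℂ)) ^ 2 :=
    hdist.trans (Finset.single_le_sum (f := fun e => frobNorm ((U' e : Matrix (Fin 2) (Fin 2) ℂ) - (V e : Matrix (Fin 2) (Fin 2) ℂ)) ^ 2) (fun e _ => sq_nonneg _)
      (Finset.mem_univ e₀))
  calc transferKernel su2Rep β U' V ≤ latE L β U' V := transferKernel_le_latE hβ U' V
    _ = Real.exp (2 * β) ^ Fintype.card (Edge 3 L) * Real.exp (-(β / 2 * ∑ e, frobNorm ((U' e : Matrix (Fin 2) (Fin 2) ℂ) - (V e : Matrix (Fin 2) (Fin 2) ℂ)) ^ 2)) :=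
        latE_eq_exp_frobSq β U' V
    _ ≤ Real.exp (2 * β) ^ Fintype.card (Edge 3 L) * Real.exp (-(β * ρ ^ 2 / 4)) := by
        refine mul_le_mul_of_nonneg_left (Real.exp_le_exp.2 ?_) (by positivity)
        nlinarith

/-! ## §3 The core part of an integral in the chart -/

/-- ★ **The core part lives on the chart ball**: for a bounded measurable `F`,
`∫ 𝟙_{gnCore ρ}·F dμ = ∫_w 𝟙{∀e, Σ_a w_e a² ≤ ρ²}·(∏_e w(w_e))·F(P(w)) dw`. [folklore] -/
theorem integral_indicator_gnCore_eq_chart (ρ : ℝ) {F : GaugeConfig 3 L SU2 → ℝ} (hF : Measurable F) (hb : ∃ C : ℝ, ∀ U, |F U| ≤ C) :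
    ∫ U, (gnCore L ρ).indicator F U ∂configMeasure SU2 L =
      ∫ w : Edge 3 L → Fin 3 → ℝ, {w : Edge 3 L → Fin 3 → ℝ | ∀ e, ∑ a, w e a ^ 2 ≤ ρ ^ 2}.indicator
        (fun w => latGnDensityReal L w * F (latPatternChart L (fun _ => false) w)) w := by
  obtain ⟨C, hC⟩ := hb
  have hC0 : 0 ≤ C := (abs_nonneg _).trans (hC 1)
  rw [integral_configMeasure_eq_vacuumChart L (hF.indicator (measurableSet_gnCore ρ)) ⟨C, fun U => ?_⟩ fun V hV => ?_]
  · refine integral_congr_ae (ae_of_all _ fun w => ?_)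
    beta_reduce
    by_cases hw : w ∈ {w : Edge 3 L → Fin 3 → ℝ | ∀ e, ∑ a, w e a ^ 2 ≤ ρ ^ 2}
    · rw [Set.indicator_of_mem hw, Set.indicator_of_mem ((latPatternChart_mem_gnCore_iff ρ w).2 hw)]
    · rw [Set.indicator_of_notMem hw, Set.indicator_of_notMem (fun h => hw ((latPatternChart_mem_gnCore_iff ρ w).1 h)), mul_zero]
  · by_cases hU : U ∈ gnCore L ρ
    · rw [Set.indicator_of_mem hU]; exact hC U
    · rw [Set.indicator_of_notMem hU, abs_zero]; exact hC0
  · exact Set.indicator_of_notMem (not_mem_gnCore_of_scalarPart_nonpos hV) _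

/-! ## §4 Pointwise sandwich on the ball -/

/-- On the ball `Σ_a w_e a² ≤ ρ²`, `Σ_a w'_e a² ≤ ρ²` (every link): `‖chartVec w' − chartVec w‖² ≤ 4|E|ρ²`. [folklore] -/
theorem norm_chartVec_sub_sq_le_of_ball {ρ : ℝ} {w w' : Edge 3 L → Fin 3 → ℝ} (hw : ∀ e, ∑ a, w e a ^ 2 ≤ ρ ^ 2) (hw' : ∀ e, ∑ a, w' e a ^ 2 ≤ ρ ^ 2) :
    ‖chartVec w' - chartVec w‖ ^ 2 ≤ 4 * Fintype.card (Edge 3 L) * ρ ^ 2 := by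
  rw [← sum_sub_sq_eq_norm_chartVec_sub]
  have hle : ∀ e, ∑ a, (w' e a - w e a) ^ 2 ≤ 4 * ρ ^ 2 := fun e => by
    have h2 : ∑ a, (w' e a - w e a) ^ 2 ≤ ∑ a, (2 * w' e a ^ 2 + 2 * w e a ^ 2) :=
      Finset.sum_le_sum fun a _ => by nlinarith [sq_nonneg (w' e a + w e a)]
    rw [Finset.sum_add_distrib, ← Finset.mul_sum, ← Finset.mul_sum] at h2
    linarith [hw e, hw' e]
  calc ∑ e, ∑ a, (w' e a - w e a) ^ 2 ≤ ∑ _e : Edge 3 L, 4 * ρ ^ 2 := Finset.sum_le_sum fun e _ => hle e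
    _ = 4 * Fintype.card (Edge 3 L) * ρ ^ 2 := by rw [Finset.sum_const, Finset.card_univ, nsmul_eq_mul]; ring

/-- The upper kinetic Gaussian against the model one on the ball: `e^{−β(1+ρ²)⁻²‖d‖²} ≤ e^{8|E|βρ⁴}·e^{−β‖d‖²}` (`β ≥ 0`, `‖d‖² ≤ 4|E|ρ²`). [folklore] -/
theorem exp_kinetic_upper_le {β ρ : ℝ} (hβ : 0 ≤ β) {w w' : Edge 3 L → Fin 3 → ℝ} (hw : ∀ e, ∑ a, w e a ^ 2 ≤ ρ ^ 2) (hw' : ∀ e, ∑ a, w' e a ^ 2 ≤ ρ ^ 2) :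
    Real.exp (-(β / (1 + ρ ^ 2) ^ 2 * ‖chartVec w' - chartVec w‖ ^ 2)) ≤
      Real.exp (8 * Fintype.card (Edge 3 L) * β * ρ ^ 4) * Real.exp (-(β * ‖chartVec w' - chartVec w‖ ^ 2)) := by
  rw [← Real.exp_add]
  refine Real.exp_le_exp.2 ?_
  set D := ‖chartVec w' - chartVec w‖ ^ 2 with hD
  have hD0 : 0 ≤ D := by positivity
  have hDle := norm_chartVec_sub_sq_le_of_ball (L := L) hw hw'
  rw [← hD] at hDle
  have hq : 0 < (1 + ρ ^ 2) ^ 2 := by positivity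
  -- `β D (1 − (1+ρ²)⁻²) ≤ β D · 2ρ² ≤ 8|E|βρ⁴`
  have h1 : β * D - β / (1 + ρ ^ 2) ^ 2 * D = β * D * (1 - 1 / (1 + ρ ^ 2) ^ 2) := by ring
  have h2 : 1 - 1 / (1 + ρ ^ 2) ^ 2 ≤ 2 * ρ ^ 2 := by
    have hinv : 1 - 2 * ρ ^ 2 ≤ 1 / (1 + ρ ^ 2) ^ 2 := by
      rw [le_div_iff₀ hq]; nlinarith [sq_nonneg ρ, sq_nonneg (ρ ^ 2), sq_nonneg (ρ ^ 3)]
    linarith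
  have h3 : β * D - β / (1 + ρ ^ 2) ^ 2 * D ≤ β * D * (2 * ρ ^ 2) := by
    rw [h1]; exact mul_le_mul_of_nonneg_left h2 (by positivity)
  nlinarith [mul_le_mul_of_nonneg_left hDle (show 0 ≤ β * (2 * ρ ^ 2) by positivity)]

/-- ★ **The pointwise sandwich on the ball, lower half.**  For `0 ≤ β`, `0 ≤ ρ ≤ 1/2`, both `w, w'` in the ball and `g₋·e^{−q(x_w)} ≤ G(P w)` (`g₋ ≥ 0`), with the flat model
integrand `m(w) = e^{−⟪x',Ax'⟫}e^{−β‖x'−x_w‖²}e^{−⟪x_w,Ax_w⟫}e^{−q(x_w)}` (`x' = chartVec w'`, `A = (β/2)H`, `q = stiffGaussExp L (β/2) β`):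
`e^{2β|E|}((2π²)⁻¹(1+ρ²)⁻²)^{|E|}e^{−2000|P|ρ³β}·g₋·m(w) ≤ (∏_e w(w_e))·K_β(P w', P w)·G(P w)`. [cite: Luscher1983, §3] -/
theorem chart_integrand_lower {β : ℝ} (hβ : 0 ≤ β) {ρ : ℝ} (hρ0 : 0 ≤ ρ) (hρ2 : ρ ≤ 1 / 2) {w w' : Edge 3 L → Fin 3 → ℝ} (hw : ∀ e, ∑ a, w e a ^ 2 ≤ ρ ^ 2)
    (hw' : ∀ e, ∑ a, w' e a ^ 2 ≤ ρ ^ 2) {G : GaugeConfig 3 L SU2 → ℝ} {gm : ℝ} (hgm : 0 ≤ gm)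
    (hG : gm * Real.exp (-stiffGaussExp L (β / 2) β (chartVec w)) ≤ G (latPatternChart L (fun _ => false) w)) :
    Real.exp (2 * β) ^ Fintype.card (Edge 3 L) * ((2 * π ^ 2)⁻¹ * ((1 + ρ ^ 2)⁻¹) ^ 2) ^ Fintype.card (Edge 3 L) *
          Real.exp (-(2000 * Fintype.card (Plaquette 3 L) * ρ ^ 3 * β)) * gm *
        (Real.exp (-⟪chartVec w', ((β / 2) • stiffHessian L) (chartVec w')⟫) * Real.exp (-(β * ‖chartVec w' - chartVec w‖ ^ 2)) *
          Real.exp (-⟪chartVec w, ((β / 2) • stiffHessian L) (chartVec w)⟫) * Real.exp (-stiffGaussExp L (β / 2) β (chartVec w))) ≤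
      latGnDensityReal L w * transferKernel su2Rep β (latPatternChart L (fun _ => false) w') (latPatternChart L (fun _ => false) w) * G (latPatternChart L (fun _ => false) w) := by
  obtain ⟨hKlo, _⟩ := transferKernel_chart_sandwich L hβ hρ0 hρ2 w' w hw' hw
  have hdlo := latGnDensityReal_ge_of_ball L w hw
  have hd0 := (latGnDensityReal_pos_le L w).1.le
  have hK0 := (transferKernel_pos su2Rep β (latPatternChart L (fun _ => false) w') (latPatternChart L (fun _ => false) w)).le
  have hQ0 := (Real.exp_pos (-stiffGaussExp L (β / 2) β (chartVec w))).le
  set E1 := Real.exp (-⟪chartVec w', ((β / 2) • stiffHessian L) (chartVec w')⟫) with hE1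
  set E2 := Real.exp (-(β * ‖chartVec w' - chartVec w‖ ^ 2)) with hE2
  set E3 := Real.exp (-⟪chartVec w, ((β / 2) • stiffHessian L) (chartVec w)⟫) with hE3
  set Q := Real.exp (-stiffGaussExp L (β / 2) β (chartVec w)) with hQ
  set K := transferKernel su2Rep β (latPatternChart L (fun _ => false) w') (latPatternChart L (fun _ => false) w) with hK
  set d := latGnDensityReal L w with hd
  set Gw := G (latPatternChart L (fun _ => false) w) with hGw
  set cE := Real.exp (2 * β) ^ Fintype.card (Edge 3 L) with hcE
  set cM := Real.exp (-(2000 * Fintype.card (Plaquette 3 L) * ρ ^ 3 * β)) with hcM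
  set dlo := ((2 * π ^ 2)⁻¹ * ((1 + ρ ^ 2)⁻¹) ^ 2) ^ Fintype.card (Edge 3 L) with hdlo'
  calc cE * dlo * cM * gm * (E1 * E2 * E3 * Q) = dlo * (cE * cM * (E1 * E2 * E3)) * (gm * Q) := by ring
    _ ≤ d * K * Gw := mul_le_mul (mul_le_mul hdlo hKlo (by positivity) hd0) hG (mul_nonneg hgm hQ0) (mul_nonneg hd0 hK0)

/-- ★ **The pointwise sandwich on the ball, upper half.**  For `0 ≤ β`, `0 ≤ ρ ≤ 1/2`, both `w, w'` in the ball and `0 ≤ G(P w) ≤ G⁺`: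
`(∏_e w(w_e))·K_β(P w', P w)·G(P w) ≤ e^{2β|E|}(2π²)^{−|E|}e^{2000|P|ρ³β}e^{8|E|βρ⁴}·G⁺·e^{−⟪x',Ax'⟫}e^{−β‖x'−x_w‖²}e^{−⟪x_w,Ax_w⟫}`. [cite: Luscher1983, §3] -/
theorem chart_integrand_upper {β : ℝ} (hβ : 0 ≤ β) {ρ : ℝ} (hρ0 : 0 ≤ ρ) (hρ2 : ρ ≤ 1 / 2) {w w' : Edge 3 L → Fin 3 → ℝ} (hw : ∀ e, ∑ a, w e a ^ 2 ≤ ρ ^ 2)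
    (hw' : ∀ e, ∑ a, w' e a ^ 2 ≤ ρ ^ 2) {G : GaugeConfig 3 L SU2 → ℝ} {Gup : ℝ} (hG0 : 0 ≤ G (latPatternChart L (fun _ => false) w))
    (hG : G (latPatternChart L (fun _ => false) w) ≤ Gup) :
    latGnDensityReal L w * transferKernel su2Rep β (latPatternChart L (fun _ => false) w') (latPatternChart L (fun _ => false) w) * G (latPatternChart L (fun _ => false) w) ≤
      Real.exp (2 * β) ^ Fintype.card (Edge 3 L) * ((2 * π ^ 2)⁻¹) ^ Fintype.card (Edge 3 L) * Real.exp (2000 * Fintype.card (Plaquette 3 L) * ρ ^ 3 * β) *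
          Real.exp (8 * Fintype.card (Edge 3 L) * β * ρ ^ 4) * Gup *
        (Real.exp (-⟪chartVec w', ((β / 2) • stiffHessian L) (chartVec w')⟫) * Real.exp (-(β * ‖chartVec w' - chartVec w‖ ^ 2)) *
          Real.exp (-⟪chartVec w, ((β / 2) • stiffHessian L) (chartVec w)⟫)) := by
  obtain ⟨_, hKhi⟩ := transferKernel_chart_sandwich L hβ hρ0 hρ2 w' w hw' hw
  have hdhi := (latGnDensityReal_pos_le L w).2
  have hK0 := (transferKernel_pos su2Rep β (latPatternChart L (fun _ => false) w') (latPatternChart L (fun _ => false) w)).le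
  have hkin := exp_kinetic_upper_le (L := L) hβ hw hw'
  set E1 := Real.exp (-⟪chartVec w', ((β / 2) • stiffHessian L) (chartVec w')⟫) with hE1
  set E2 := Real.exp (-(β * ‖chartVec w' - chartVec w‖ ^ 2)) with hE2
  set E2' := Real.exp (-(β / (1 + ρ ^ 2) ^ 2 * ‖chartVec w' - chartVec w‖ ^ 2)) with hE2'
  set E3 := Real.exp (-⟪chartVec w, ((β / 2) • stiffHessian L) (chartVec w)⟫) with hE3
  set K := transferKernel su2Rep β (latPatternChart L (fun _ => false) w') (latPatternChart L (fun _ => false) w) with hK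
  set d := latGnDensityReal L w with hd
  set Gw := G (latPatternChart L (fun _ => false) w) with hGw
  set cE := Real.exp (2 * β) ^ Fintype.card (Edge 3 L) with hcE
  set cM' := Real.exp (2000 * Fintype.card (Plaquette 3 L) * ρ ^ 3 * β) with hcM'
  set c8 := Real.exp (8 * Fintype.card (Edge 3 L) * β * ρ ^ 4) with hc8
  set dhi := ((2 * π ^ 2)⁻¹ : ℝ) ^ Fintype.card (Edge 3 L) with hdhi'
  have hKhi' : K ≤ cE * cM' * c8 * (E1 * E2 * E3) := by
    calc K ≤ cE * cM' * (E1 * E2' * E3) := hKhi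
      _ ≤ cE * cM' * (E1 * (c8 * E2) * E3) := by gcongr
      _ = cE * cM' * c8 * (E1 * E2 * E3) := by ring
  calc d * K * Gw ≤ dhi * (cE * cM' * c8 * (E1 * E2 * E3)) * Gup := mul_le_mul (mul_le_mul hdhi hKhi' hK0 (by positivity)) hG hG0 (by positivity)
    _ = cE * dhi * cM' * c8 * Gup * (E1 * E2 * E3) := by ring

/-! ## §5 Integrability and the core part of `∫ K_β(P w', ·)·G dμ` -/

/-- Bounded measurable functions of `SU(2)^E` times the kernel are integrable (also after restriction to a measurable set), and the kernel is bounded. [folklore] -/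
theorem integrable_transferKernel_mul (β : ℝ) (U' : GaugeConfig 3 L SU2) {G : GaugeConfig 3 L SU2 → ℝ} (hGm : Measurable G) {CG : ℝ} (hCG : ∀ V, |G V| ≤ CG) :
    ∃ M : ℝ, 0 ≤ M ∧ (∀ U V : GaugeConfig 3 L SU2, transferKernel su2Rep β U V ≤ M) ∧
      Integrable (fun V => transferKernel su2Rep β U' V * G V) (configMeasure SU2 L) ∧
      ∀ S : Set (GaugeConfig 3 L SU2), MeasurableSet S → Integrable (fun V => S.indicator (fun V => transferKernel su2Rep β U' V * G V) V) (configMeasure SU2 L) := by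
  obtain ⟨M, hM⟩ := exists_transferKernel_le su2Rep continuous_su2Rep β (L := L)
  have hM0 : 0 ≤ M := (transferKernel_pos su2Rep β (1 : GaugeConfig 3 L SU2) 1).le.trans (hM 1 1)
  have hKm : Measurable fun V => transferKernel su2Rep β U' V := measurable_transferKernel_left β U'
  have hint : Integrable (fun V => transferKernel su2Rep β U' V * G V) (configMeasure SU2 L) :=
    integrable_of_measurable_abs_le _ (hKm.mul hGm) (C := M * CG) fun V => by
      rw [abs_mul, abs_of_pos (transferKernel_pos su2Rep β _ _)]; exact mul_le_mul (hM _ _) (hCG V) (abs_nonneg _) hM0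
  exact ⟨M, hM0, hM, hint, fun S hS => hint.indicator hS⟩

/-- The chart integrand `w ↦ 𝟙_ball(w)·(∏ w(w_e))·K_β(P w', P w)·G(P w)` is measurable. [folklore] -/
theorem measurable_chart_integrand (β ρ : ℝ) (w' : Edge 3 L → Fin 3 → ℝ) {G : GaugeConfig 3 L SU2 → ℝ} (hGm : Measurable G) :
    Measurable fun w : Edge 3 L → Fin 3 → ℝ => {w : Edge 3 L → Fin 3 → ℝ | ∀ e, ∑ a, w e a ^ 2 ≤ ρ ^ 2}.indicator
      (fun w => latGnDensityReal L w * transferKernel su2Rep β (latPatternChart L (fun _ => false) w') (latPatternChart L (fun _ => false) w) *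
        G (latPatternChart L (fun _ => false) w)) w := by
  refine Measurable.indicator ?_ (measurableSet_chartBall ρ)
  exact ((measurable_latGnDensityReal L).mul ((measurable_transferKernel_left β _).comp (measurable_latPatternChart L _))).mul
    (hGm.comp (measurable_latPatternChart L _))

/-- The shifted Gaussian is integrable on the chart: `w ↦ e^{−b‖x − chartVec w‖²}` (`b > 0`). [folklore] -/
theorem integrable_gauss_shift_chart {b : ℝ} (hb : 0 < b) (x : LinkSpace L) : Integrable fun w : Edge 3 L → Fin 3 → ℝ => Real.exp (-(b * ‖x - chartVec w‖ ^ 2)) := by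
  have h := ((volume_preserving_chartEquiv L).integrable_comp_emb (chartEquiv L).measurableEmbedding).2 (integrable_gauss_shift hb x)
  refine (by simpa only [Function.comp_def, chartEquiv_apply] using h : Integrable fun w : Edge 3 L → Fin 3 → ℝ => Real.exp (-b * ‖chartVec w - x‖ ^ 2)).congr
    (ae_of_all _ fun w => ?_)
  beta_reduce; rw [norm_sub_rev]; ring_nf

/-- The core part of `∫ K_β(P w', ·)·G dμ` in the chart, and the elementary facts about it used by both bounds. [folklore] -/
theorem core_part_eq_chart (β ρ : ℝ) (w' : Edge 3 L → Fin 3 → ℝ) {G : GaugeConfig 3 L SU2 → ℝ} (hGm : Measurable G) {CG : ℝ} (hCG : ∀ V, |G V| ≤ CG) :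
    ∫ V, (gnCore L ρ).indicator (fun V => transferKernel su2Rep β (latPatternChart L (fun _ => false) w') V * G V) V ∂configMeasure SU2 L =
      ∫ w : Edge 3 L → Fin 3 → ℝ, {w : Edge 3 L → Fin 3 → ℝ | ∀ e, ∑ a, w e a ^ 2 ≤ ρ ^ 2}.indicator
        (fun w => latGnDensityReal L w * transferKernel su2Rep β (latPatternChart L (fun _ => false) w') (latPatternChart L (fun _ => false) w) *
          G (latPatternChart L (fun _ => false) w)) w := by
  obtain ⟨M, hM0, hM, _, _⟩ := integrable_transferKernel_mul β (latPatternChart L (fun _ => false) w') hGm hCG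
  rw [integral_indicator_gnCore_eq_chart ρ (F := fun V => transferKernel su2Rep β (latPatternChart L (fun _ => false) w') V * G V)
    ((measurable_transferKernel_left β _).mul hGm) ⟨M * CG, fun V => by
      rw [abs_mul, abs_of_pos (transferKernel_pos su2Rep β _ _)]; exact mul_le_mul (hM _ _) (hCG V) (abs_nonneg _) hM0⟩]
  refine integral_congr_ae (ae_of_all _ fun w => ?_)
  by_cases hw : w ∈ {w : Edge 3 L → Fin 3 → ℝ | ∀ e, ∑ a, w e a ^ 2 ≤ ρ ^ 2}
  · rw [Set.indicator_of_mem hw, Set.indicator_of_mem hw, mul_assoc]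
  · rw [Set.indicator_of_notMem hw, Set.indicator_of_notMem hw]

end Summit.QuantumFields.YangMills.Theorems.FemtoTransferGap.TwoLattice.ConstTube

end
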